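import Summits.AtomisticToContinuum.FouriersLaw.Theses.MatthiessenLadder
import Summits.AtomisticToContinuum.FouriersLaw.Theorems.MatthiessenLadderPrefixSteadyStatesStubSteadyStateOfSemigroupBound
import Summits.AtomisticToContinuum.FouriersLaw.Theorems.MatthiessenLadderPrefixSteadyStatesStubHarmonicNessUnique
import Summits.AtomisticToContinuum.FouriersLaw.Theorems.MatthiessenLadderPrefixSteadyStatesStubPrefixResponseZero
import Summits.AtomisticToContinuum.FouriersLaw.Theorems.MatthiessenLadderPrefixSteadyStatesStubCellChainSmoothDensity
import Summits.AtomisticToContinuum.FouriersLaw.Theorems.MatthiessenLadderPrefixSteadyStatesStubCellChainInvariantUnique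
import Summits.AtomisticToContinuum.FouriersLaw.Theorems.MatthiessenLadderPrefixSteadyStatesStubCellChainInvariantOfSteadyState
import Summits.AtomisticToContinuum.FouriersLaw.Theorems.MatthiessenLadderPrefixSteadyStatesStubPrefixResponseOfUniformMixing
import Summits.AtomisticToContinuum.FouriersLaw.Theorems.MatthiessenLadderPrefixSteadyStatesStubPrefixWindowDecay
import Summits.AtomisticToContinuum.FouriersLaw.Theorems.MatthiessenLadderPrefixSteadyStatesStubPrefixExpBound
import Summits.AtomisticToContinuum.FouriersLaw.Theorems.MatthiessenLadderPrefixSteadyStatesStubPrefixEnergyScale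
import Summits.AtomisticToContinuum.FouriersLaw.Theorems.MatthiessenLadderPrefixSteadyStatesStubPrefixHostObservability
import Summits.AtomisticToContinuum.FouriersLaw.Theorems.MatthiessenLadderPrefixSteadyStatesStubPrefixMixingOfDecay
import Summits.AtomisticToContinuum.FouriersLaw.Theorems.MatthiessenLadderPrefixSteadyStatesStubPrefixLimitDissipation
import Summits.AtomisticToContinuum.FouriersLaw.Theorems.MatthiessenLadderPrefixSteadyStatesStubPrefixUniformDecay
import Literature.MathematicalPhysics.KineticTheory.CellChainLangevin
import Literature.MathematicalPhysics.KineticTheory.SiteChainLyapunovInvariant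
import Literature.MathematicalPhysics.KineticTheory.HarmonicChainNESS
import Literature.Probability.Process.BrownianSupTail

/-!
# Registered stub `stub_prefixCesaroEnergyBoundR17`: the Cesàro energy bound of the MIXED rung (from the landed decay)

`--supports stmt-AtomisticToContinuum-12778` (crux `MatthiessenLadder.PrefixSteadyStates`, line `registered`, r17 split of the
sorry-free closing file, which exceeds the 400-line limit): registered stub `stub_prefixCesaroEnergyBoundR17`, PROVED here from the landed
stubs exactly as in the lead's skeleton (lead c3).
-/

noncomputable section



namespace Summit.AtomisticToContinuum.FouriersLaw.Theorems.PrefixSteadyStates.LineRegistered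

open MeasureTheory Filter Topology
open scoped NNReal ENNReal BoundedContinuousFunction ContDiff
open Literature.MathematicalPhysics.KineticTheory.HeatConduction
open Summit.AtomisticToContinuum.FouriersLaw.Theses.MatthiessenLadder (PrefixSteadyStates)

/-! ### A Lyapunov / H2 condition implies the Cesàro energy bound (PROVED; the form in which
CEHRB-type estimates `P_{t*} V ≤ a V + b`, `P_r V ≤ c V` (`r < t*`) will be delivered) -/

section LyapunovToCesaro

open Literature.Probability.Process Literature.MathematicalPhysics.KineticTheory
open scoped ProbabilityTheory

variable {N : ℕ}

/-- **From a Lyapunov condition to the Cesàro energy bound.** Let `κ t` be Markov kernels with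
`κ 0 = id` and Chapman–Kolmogorov, `W ≤ V` measurable weights, and suppose CEHRB's H2 at time `t* > 0`,
`κ_{t*} V ≤ a V + b` with `a < 1`, `b < ∞`, together with the local bound `κ_r V ≤ c V` (`r < t*`, `c < ∞`).
Then from every `x₀` with `V x₀ < ∞` the Cesàro means of `W` are bounded:
`∫_{(0,n+1]} κ_s W (x₀) ds ≤ (n+1) (c V x₀ + B)` (CEHRB (3.5)–(3.6) iterated,
`lintegral_kernel_le_of_lyapunov`, then integrated in time). [folklore] -/
theorem cesaro_le_of_lyapunov {X : Type*} [MeasurableSpace X] (κ : ℝ≥0 → ProbabilityTheory.Kernel X X)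
    [∀ t, ProbabilityTheory.IsMarkovKernel (κ t)]
    (h_zero : κ 0 = ProbabilityTheory.Kernel.id) (h_add : ∀ s t : ℝ≥0, κ (s + t) = κ t ∘ₖ κ s)
    {V W : X → ℝ≥0∞} (hV : Measurable V) (hWV : ∀ y, W y ≤ V y)
    {tstar : ℝ≥0} (htstar : 0 < tstar) {a b c : ℝ≥0∞} (ha : a < 1) (hb : b ≠ ⊤) (hc : c ≠ ⊤)
    (hlyap : ∀ x, ∫⁻ y, V y ∂(κ tstar x) ≤ a * V x + b)
    (hloc : ∀ r : ℝ≥0, r < tstar → ∀ x, ∫⁻ y, V y ∂(κ r x) ≤ c * V x)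
    {x₀ : X} (hx₀ : V x₀ ≠ ⊤) :
    ∃ C : ℝ≥0, ∀ n : ℕ,
      ∫⁻ s in Set.Ioc (0 : ℝ) (n + 1), ∫⁻ y, W y ∂(κ s.toNNReal x₀) ≤ ((n : ℝ≥0∞) + 1) * C := by
  obtain ⟨B, hBtop, hB⟩ := MarkovSemigroup.exists_fixedBound ha hb
  have hunif : ∀ t : ℝ≥0, ∫⁻ y, W y ∂(κ t x₀) ≤ c * V x₀ + B := fun t =>
    (lintegral_mono fun y => hWV y).trans
      (MarkovSemigroup.lintegral_kernel_le_of_lyapunov κ h_zero h_add hV htstar ha.le hB hlyap hloc t x₀)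
  have hKtop : c * V x₀ + B ≠ ⊤ := ENNReal.add_ne_top.2 ⟨ENNReal.mul_ne_top hc hx₀, hBtop⟩
  refine ⟨(c * V x₀ + B).toNNReal, fun n => ?_⟩
  rw [ENNReal.coe_toNNReal hKtop]
  calc ∫⁻ s in Set.Ioc (0 : ℝ) (n + 1), ∫⁻ y, W y ∂(κ s.toNNReal x₀)
      ≤ ∫⁻ _s in Set.Ioc (0 : ℝ) (n + 1), (c * V x₀ + B) := lintegral_mono fun s => hunif _
    _ = (c * V x₀ + B) * volume (Set.Ioc (0 : ℝ) (n + 1)) := setLIntegral_const _ _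
    _ = ((n : ℝ≥0∞) + 1) * (c * V x₀ + B) := by
        rw [Real.volume_Ioc, sub_zero, mul_comm]
        congr 1
        rw [show ((n : ℝ) + 1) = ((n + 1 : ℕ) : ℝ) by push_cast; ring, ENNReal.ofReal_natCast]
        push_cast
        ring

/-- **The Cesàro energy bound of the hard stub from an H2-type Lyapunov condition for the Langevin
kernels of a cell chain** (`ω₂ > 0`, `lam, β, γ ≥ 0`, any cell indicator, `N ≥ 1`, `T_L, T_R ≥ 0`): if
some measurable `V ≥ (1+H)²` (e.g. `C_θ e^{θH}`) finite at `x₀` satisfies `P_{t*} V ≤ a V + b` (`a < 1`)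
and `P_r V ≤ c V` for `r < t*`, then the conclusion of `stub_prefixCesaroEnergyBound` holds at `x₀`. -/
theorem cellChain_cesaroEnergyBound_of_lyapunov {ω₂ lam β γ : ℝ} (hω : 0 < ω₂) (hl : 0 ≤ lam)
    (hβ : 0 ≤ β) (hγ : 0 ≤ γ) (c₀ : ℕ → Bool) {T_L T_R : ℝ}
    {V : PhaseSpace N → ℝ≥0∞} (hV : Measurable V)
    (hHV : ∀ y, ENNReal.ofReal ((1 + (cellChain ω₂ lam β γ c₀).hamiltonian N y) ^ 2) ≤ V y)
    {tstar : ℝ≥0} (htstar : 0 < tstar) {a b c : ℝ≥0∞} (ha : a < 1) (hb : b ≠ ⊤) (hc : c ≠ ⊤)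
    (hlyap : ∀ x, ∫⁻ y, V y ∂((cellChain ω₂ lam β γ c₀).langevinKernel N T_L T_R tstar x) ≤ a * V x + b)
    (hloc : ∀ r : ℝ≥0, r < tstar → ∀ x,
      ∫⁻ y, V y ∂((cellChain ω₂ lam β γ c₀).langevinKernel N T_L T_R r x) ≤ c * V x)
    {x₀ : PhaseSpace N} (hx₀ : V x₀ ≠ ⊤) :
    ∃ C : ℝ≥0, ∀ n : ℕ,
      ∫⁻ s in Set.Ioc (0 : ℝ) (n + 1),
          ∫⁻ y, ENNReal.ofReal ((1 + (cellChain ω₂ lam β γ c₀).hamiltonian N y) ^ 2)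
            ∂((cellChain ω₂ lam β γ c₀).langevinKernel N T_L T_R s.toNNReal x₀) ≤ ((n : ℝ≥0∞) + 1) * C := by
  have hP := cellChain_uniformlyConfining hω hl hβ hγ c₀
  haveI : ∀ t, ProbabilityTheory.IsMarkovKernel ((cellChain ω₂ lam β γ c₀).langevinKernel N T_L T_R t) :=
    fun t => hP.isMarkovKernel_langevinKernel N T_L T_R t
  exact cesaro_le_of_lyapunov _ (hP.langevinKernel_zero N T_L T_R) (hP.langevinKernel_add N T_L T_R) hV hHV
    htstar ha hb hc hlyap hloc hx₀

end LyapunovToCesaro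

/-- `(1 + h)² ≤ (2 + 4/θ²) e^{θh}` for `h ≥ 0`, `θ > 0`. [folklore] -/
theorem one_add_sq_le_mul_exp {θ h : ℝ} (hθ : 0 < θ) (hh : 0 ≤ h) :
    (1 + h) ^ 2 ≤ (2 + 4 / θ ^ 2) * Real.exp (θ * h) := by
  have h1 : 1 ≤ Real.exp (θ * h) := Real.one_le_exp (by positivity)
  have h2 : (θ * h) ^ 2 / 2 ≤ Real.exp (θ * h) := by
    have := Real.pow_div_factorial_le_exp (θ * h) (by positivity) 2
    simpa [Nat.factorial] using this
  have hθ2 : 0 < θ ^ 2 := by positivity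
  -- `h² ≤ (2/θ²) e^{θh}`
  have h3 : θ ^ 2 * h ^ 2 ≤ 2 * Real.exp (θ * h) := by nlinarith
  have h3' : h ^ 2 ≤ 2 / θ ^ 2 * Real.exp (θ * h) := by
    rw [div_mul_eq_mul_div, le_div_iff₀ hθ2]; linarith
  have h4 : (1 + h) ^ 2 ≤ 2 + 2 * h ^ 2 := by nlinarith [sq_nonneg (1 - h)]
  have h5 : (2 : ℝ) ≤ 2 * Real.exp (θ * h) := by linarith
  calc (1 + h) ^ 2 ≤ 2 + 2 * h ^ 2 := h4
    _ ≤ 2 * Real.exp (θ * h) + 2 * (2 / θ ^ 2 * Real.exp (θ * h)) := by linarith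
    _ = (2 + 4 / θ ^ 2) * Real.exp (θ * h) := by ring

/-- **The Cesàro energy bound along the Langevin kernels of the MIXED rung** (the r4–r11 stub
`stub_prefixCesaroEnergyBound`, now PROVED from `stub_prefixUniformDecay` + `stub_prefixExpBound` through
`cellChain_cesaroEnergyBound_of_lyapunov` with `V = (2 + 4/θ²) e^{θH}`, `θ = 1/(2 max(T_L,T_R))`, `t* = 1`). -/
theorem stub_prefixCesaroEnergyBoundR17 :
    ∀ ω₂ lam β γ : ℝ, 0 < ω₂ → 0 < lam → 0 < β → 0 < γ → ∀ k N : ℕ, 0 < k → k < N →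
      ∀ T_L T_R : ℝ, 0 < T_L → 0 < T_R →
        ∃ (x₀ : PhaseSpace N) (C : ℝ≥0), ∀ n : ℕ,
          ∫⁻ s in Set.Ioc (0 : ℝ) (n + 1),
              ∫⁻ y, ENNReal.ofReal
                ((1 + (cellChain ω₂ lam β γ (fun i => decide (i < k))).hamiltonian N y) ^ 2)
                ∂((cellChain ω₂ lam β γ (fun i => decide (i < k))).langevinKernel N T_L T_R
                    s.toNNReal x₀) ≤ ((n : ℝ≥0∞) + 1) * C := by
  intro ω₂ lam β γ hω hl hβ hγ k N hk hkN T_L T_R hL hR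
  set P := cellChain ω₂ lam β γ (fun i => decide (i < k)) with hP
  set H := P.hamiltonian N with hH
  have hN : 0 < N := lt_of_le_of_lt (Nat.zero_le k) hkN
  have hUC := cellChain_uniformlyConfining hω hl.le hβ.le hγ.le (fun i => decide (i < k))
  -- the parameters
  set Tm := max T_L T_R with hTm
  have hTm0 : 0 < Tm := lt_max_of_lt_left hL
  set θ : ℝ := 1 / (2 * Tm) with hθ
  have hθ0 : 0 < θ := by positivity
  have hθ1 : θ < 1 / Tm := by
    rw [hθ]; exact one_div_lt_one_div_of_lt hTm0 (by linarith)
  obtain ⟨E₁, hE₁⟩ :=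
    Summit.AtomisticToContinuum.FouriersLaw.Theorems.PrefixSteadyStates.LineRegistered.stub_prefixUniformDecay
      ω₂ lam β γ hω hl hβ hγ k N hk hkN Tm hTm0 θ hθ0 hθ1 1 one_pos
  have hdec := hE₁ T_L T_R hL hR (le_max_left _ _) (le_max_right _ _)
  have h34 := Summit.AtomisticToContinuum.FouriersLaw.Theorems.PrefixSteadyStates.LineRegistered.stub_prefixExpBound
    ω₂ lam β γ hω hl.le hβ.le hγ (fun i => decide (i < k)) N hN T_L T_R hL hR θ hθ0 hθ1
  -- the Lyapunov function `V = Mθ e^{θH}`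
  set Mθ : ℝ := 2 + 4 / θ ^ 2 with hMθ
  have hMθ0 : 0 < Mθ := by positivity
  have hHc : Continuous H := P.continuous_hamiltonian N (fun i => (hUC.contDiff_U i).continuous)
    (fun i => (hUC.contDiff_V i).continuous)
  have hH0 : ∀ y, 0 ≤ H y := fun y => hUC.hamiltonian_nonneg N y
  set V : PhaseSpace N → ℝ≥0∞ := fun y => ENNReal.ofReal (Mθ * Real.exp (θ * H y)) with hV
  have hVm : Measurable V :=
    ENNReal.measurable_ofReal.comp (measurable_const.mul (Real.measurable_exp.comp
      (measurable_const.mul hHc.measurable)))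
  have hVsplit : ∀ y, V y = ENNReal.ofReal Mθ * ENNReal.ofReal (Real.exp (θ * H y)) := fun y => by
    rw [hV]; exact ENNReal.ofReal_mul hMθ0.le
  have hEm : Measurable fun y => ENNReal.ofReal (Real.exp (θ * H y)) :=
    ENNReal.measurable_ofReal.comp (Real.measurable_exp.comp (measurable_const.mul hHc.measurable))
  have hHV : ∀ y, ENNReal.ofReal ((1 + H y) ^ 2) ≤ V y := fun y =>
    ENNReal.ofReal_le_ofReal (one_add_sq_le_mul_exp hθ0 (hH0 y))
  -- the exponential factor of (3.4) at times `≤ 1`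
  set G : ℝ := Real.exp (θ * γ * (T_L + T_R) * (1 : ℝ≥0)) with hG
  have hG34 : ∀ (r : ℝ≥0), (r : ℝ) ≤ 1 → ∀ x, ∫⁻ y, V y ∂(P.langevinKernel N T_L T_R r x) ≤
      ENNReal.ofReal G * V x := by
    intro r hr x
    calc ∫⁻ y, V y ∂(P.langevinKernel N T_L T_R r x)
        = ENNReal.ofReal Mθ * ∫⁻ y, ENNReal.ofReal (Real.exp (θ * H y)) ∂(P.langevinKernel N T_L T_R r x) := by
          simp only [hVsplit]; exact lintegral_const_mul _ hEm
      _ ≤ ENNReal.ofReal Mθ * ENNReal.ofReal (Real.exp (θ * γ * (T_L + T_R) * r) * Real.exp (θ * H x)) := by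
          gcongr; exact h34 r x
      _ ≤ ENNReal.ofReal Mθ * (ENNReal.ofReal G * ENNReal.ofReal (Real.exp (θ * H x))) := by
          gcongr
          rw [← ENNReal.ofReal_mul (Real.exp_pos _).le]
          refine ENNReal.ofReal_le_ofReal (mul_le_mul_of_nonneg_right ?_ (Real.exp_pos _).le)
          refine Real.exp_le_exp.2 (mul_le_mul_of_nonneg_left (by simpa using hr) ?_)
          have := hγ.le; have := hL.le; have := hR.le; positivity
      _ = ENNReal.ofReal G * V x := by rw [hVsplit, mul_left_comm]
  -- H2 at `t* = 1`
  set b : ℝ≥0∞ := ENNReal.ofReal G * ENNReal.ofReal (Mθ * Real.exp (θ * E₁)) with hb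
  have hlyap : ∀ x, ∫⁻ y, V y ∂(P.langevinKernel N T_L T_R 1 x) ≤ (1 / 2 : ℝ≥0∞) * V x + b := by
    intro x
    by_cases hx : E₁ ≤ H x
    · calc ∫⁻ y, V y ∂(P.langevinKernel N T_L T_R 1 x)
          = ENNReal.ofReal Mθ * ∫⁻ y, ENNReal.ofReal (Real.exp (θ * H y)) ∂(P.langevinKernel N T_L T_R 1 x) := by
            simp only [hVsplit]; exact lintegral_const_mul _ hEm
        _ ≤ ENNReal.ofReal Mθ * ENNReal.ofReal (Real.exp (θ * H x) / 2) := by gcongr; exact hdec x hx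
        _ = (1 / 2 : ℝ≥0∞) * V x := by
            rw [hVsplit, div_eq_mul_inv, ENNReal.ofReal_mul (Real.exp_pos _).le,
              ENNReal.ofReal_inv_of_pos (by norm_num : (0:ℝ) < 2), ENNReal.ofReal_ofNat]
            rw [one_div]; ring
        _ ≤ (1 / 2 : ℝ≥0∞) * V x + b := le_self_add
    · have hx' : H x ≤ E₁ := le_of_lt (not_le.1 hx)
      calc ∫⁻ y, V y ∂(P.langevinKernel N T_L T_R 1 x) ≤ ENNReal.ofReal G * V x := hG34 1 (by simp) x
        _ ≤ b := by
            rw [hb]; gcongr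
            exact ENNReal.ofReal_le_ofReal
              (mul_le_mul_of_nonneg_left (Real.exp_le_exp.2 (mul_le_mul_of_nonneg_left hx' hθ0.le)) hMθ0.le)
        _ ≤ (1 / 2 : ℝ≥0∞) * V x + b := le_add_self
  have hloc : ∀ r : ℝ≥0, r < 1 → ∀ x, ∫⁻ y, V y ∂(P.langevinKernel N T_L T_R r x) ≤ ENNReal.ofReal G * V x :=
    fun r hr x => hG34 r (by exact_mod_cast hr.le) x
  obtain ⟨C, hC⟩ := cellChain_cesaroEnergyBound_of_lyapunov (N := N) hω hl.le hβ.le hγ.le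
    (fun i => decide (i < k)) (T_L := T_L) (T_R := T_R) hVm hHV one_pos
    (a := 1 / 2) (b := b) (c := ENNReal.ofReal G) (by rw [one_div]; exact ENNReal.inv_lt_one.2 (by norm_num))
    (ENNReal.mul_ne_top ENNReal.ofReal_ne_top ENNReal.ofReal_ne_top) ENNReal.ofReal_ne_top hlyap hloc
    (x₀ := 0) ENNReal.ofReal_ne_top
  exact ⟨0, C, hC⟩


end Summit.AtomisticToContinuum.FouriersLaw.Theorems.PrefixSteadyStates.LineRegistered
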